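import Summits.BirchSwinnertonDyer.BirchSwinnertonDyer.Theorems.SchneiderFreeAdditiveX3GoodMemberNonsplit
import Summits.BirchSwinnertonDyer.Rank1Residual.Partition.EisensteinKernelReductionLine
import Literature.NumberTheory.EllipticCurves.Rank1Residual.GVParityTwistTransportProofs
import Literature.NumberTheory.EllipticCurves.SerreOpenImageReductionInertiaProofs
import Literature.NumberTheory.GaloisRepresentations.ArtinLFunctionDirichletProofs
import Literature.NumberTheory.GaloisRepresentations.RatPlaceTwoProofs
import Literature.NumberTheory.EllipticCurves.KellerYin2024.PotentiallyGoodOrdinaryIwasawaTheory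
import Literature.NumberTheory.EllipticCurves.BSDQuadraticDescentTorsionOddPartProofs
import Literature.NumberTheory.QuadraticFields.SquareRootGenerator
import HarnessLib

/-!
# Route `SchneiderFreeAdditiveX3` (K1 door), crux `GordTwoBranchIMC` (stmt-BirchSwinnertonDyer-19177),
# layer 2 (KY-reading), antecedent F-W «good member», file 2 of 3: ONE OF THE TWO NON-SPLIT MEMBERS
# IS GOOD — its unique rational `p`-line is not `Γ_ℚ`-fixed, not sign-isotypic, not `D_p`-fixed; hence
# no rational `p`-torsion on it or on its twist, and `W(K)[p] = 0` for `K` quadratic unramified at `p`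

Cell `bsd-schneider-ideate` (HOME `run/shared/lean/pub/bsd-schneider-ideate/`), seat `door-c4` gen 7;
file 2 of 3 (file 1 `SchneiderFreeAdditiveX3GoodMemberNonsplit.lean`, file 3
`SchneiderFreeAdditiveX3GoodMember.lean` = the door-level statement). PARTITION: board row
B6 ∩ X3 ∩ sst-twist, r = 1, (G-ord, `e = 2`) cell; types-the-object-of the hypothesis «GoodMember(∀)»
of door-c3 g7's `xac_charIdeal_map_le_of_KY_OPEN` (p472079; memo `KY24b-anatomy-P2-g12.md` §4 "K-W");
closes nothing. HONEST FRAMING: kernel lemmas on `E[p]` along the `ℚ`-isogeny class, fact-free; BSD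
is not advanced; THEOREMS ONLY (no definition, no named fact, no `sorry`).

## What is proved

* §1 `exists_member_uniqueLine` — **one of the two non-split members is good.** For `E/ℚ` elliptic,
  `p` odd, `Φ ≤ E[p]` a rational line and `d ∈ ℤ` with `p ∤ d`: walking twice through maximal stable
  cyclic quotients (file 1, `exists_maximalCyclicQuotient`) gives members `E₁ = E/C`, `E₂ = E₁/C₁`
  whose `p`-torsion has a UNIQUE rational line `L₁`, `L₂`. Take `τ` in an inertia group above `p`
  with `χ̄_p(τ) = 2` (tree `exists_mem_inertia_modNCyclotomicCharacter_eq`); `τ` fixes `√d`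
  (`p ∤ 4d`, tree `smul_geomSqrt_eq_of_mem_inertia`) (`exists_decomposition_cyclotomic_two_smul_geomSqrt`).
  If `E₁` is bad — `L₁` pointwise fixed by `Γ_ℚ`, or acted on through the sign character of `√d`, or
  fixed by the decomposition groups at `p` — then `τ` fixes `L₁`, hence acts on `L₂ ≅ E₁[p]/L₁` by
  `χ̄_p(τ) = 2 ≠ 1` (file 1 §3, Mazur (5.4)), so `E₂` is good. Output: a globally minimal member `W`,
  `g : E → W` of degree `p^k`, and its unique rational line `L`, not fixed / not sign-isotypic / not
  `D_p`-fixed (`¬ LineDecompositionTrivialAt`, Keller–Yin's `φ|_{G_p} ≠ 𝟙`).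
* §2 consequences for such `(W, L)`: `E[p]^{Γ_ℚ} = 0` (`eq_zero_of_forall_smul_eq`); no rational point
  of order `p` on `W` (`addOrderOf_ne`) nor on the twist `W^{(d)}` (`addOrderOf_ne_twist`, along the
  sign-equivariant `W^{(d)}[p] ≃ W[p]`, tree `exists_signEquiv_of_twist`, Silverman *AEC* X.5.4);
  `primaryComponent_eq_bot_of_forall_addOrderOf_ne`; hence **`W(K)[p] = 0`** for `[K : ℚ] = 2`,
  `p ∤ d_K`, by the odd-part quadratic descent `#W(K)[p^∞] = #W(ℚ)[p^∞] · #W^{(d_K)}(ℚ)[p^∞]` (tree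
  `card_primaryComponent_point_baseChange_quadratic_of_odd'`, *AEC* Ex. 10.16)
  (`forall_baseChange_nsmul_eq_zero`).

References: T. Keller, M. Yin, arXiv:2410.23241 §3.1 (`φ|_{G_p} ≠ 𝟙`, `E(K)[p] = 0`)
[KellerYin2024PotOrd]; B. Mazur, Publ. Math. IHÉS 47 (1977) III §5 (5.4) [Mazur1977]; J. H. Silverman,
*AEC* 2nd ed. III.4.12, III.8, X.5.4, Exercise 10.16, IX.6.2 [SilvermanAEC2009];
HOME/memos/KY24b-anatomy-P2-g12.md §4 (K-W).
-/

set_option linter.dupNamespace false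
set_option autoImplicit false

noncomputable section

open scoped Classical NumberField

open WeierstrassCurve NumberField IsDedekindDomain Literature.NumberTheory.EllipticCurves
  Literature.NumberTheory.EllipticCurves.Rank1Residual
  Literature.NumberTheory.GaloisRepresentations Field Rat.HeightOneSpectrum
  Literature.NumberTheory.EllipticCurves.KellerYin2024
  Literature.NumberTheory.QuadraticFields
  Summit.BirchSwinnertonDyer.Rank1Residual.X1.StableCyclicQuotient
  Summit.BirchSwinnertonDyer.Rank1Residual

namespace Summit.BirchSwinnertonDyer.BirchSwinnertonDyer.Theorems.SchneiderFree.GoodMember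

variable {p : ℕ} [hp : Fact p.Prime]

/-! ## §1 One of the two non-split members is good -/

section TwoStep

/-- **An inertia element above `p` with `χ̄_p(τ) = 2` fixing `√d`** (`p` odd, `p ∤ d`): `ℚ(μ_p)/ℚ` is
totally ramified at `p` (tree `exists_mem_inertia_modNCyclotomicCharacter_eq`) and `ℚ(√d)/ℚ` is
unramified at `p` (tree `smul_geomSqrt_eq_of_mem_inertia`); `I_𝔓 ≤ D_𝔓`. [folklore] -/
theorem exists_decomposition_cyclotomic_two_smul_geomSqrt (hp2 : p ≠ 2) {d : ℤ}
    (hpd : ¬ (p : ℤ) ∣ d) :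
    ∃ (v : HeightOneSpectrum (𝓞 ℚ)) (𝔓 : Ideal (absIntegers (𝓞 ℚ) ℚ)) (τ : absoluteGaloisGroup ℚ),
      (p : 𝓞 ℚ) ∈ v.asIdeal ∧ 𝔓 ∈ v.primesAbove ∧
      τ ∈ 𝔓.decompositionSubgroup (absoluteGaloisGroup ℚ) ∧
      ((((modPCyclotomicCharacterZMod ℚ p τ : (ZMod p)ˣ) : ZMod p).val : ℤ)) = 2 ∧
      τ • geomSqrt ((d : ℤ) : ℚ) = geomSqrt ((d : ℤ) : ℚ) := by
  have hp' : p.Prime := hp.out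
  have h2le := hp'.two_le
  have h3le : 3 ≤ p := by omega
  set v := (primesEquiv (R := 𝓞 ℚ)).symm ⟨p, hp'⟩ with hvdef
  have hvp : (primesEquiv v : ℕ) = p :=
    congrArg Subtype.val ((primesEquiv (R := 𝓞 ℚ)).apply_symm_apply ⟨p, hp'⟩)
  have hv : (p : 𝓞 ℚ) ∈ v.asIdeal := KernelDisc.natCast_mem_asIdeal_primesEquiv_symm
  obtain ⟨𝔓, -, h𝔓⟩ := exists_ideal_placeOver p hvp
  have hvgen : Rat.HeightOneSpectrum.natGenerator v = p := Rat.natGenerator_eq_of_prime_mem v hp' hv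
  have hcop : Nat.Coprime 2 p := (Nat.coprime_primes Nat.prime_two hp').mpr (Ne.symm hp2)
  obtain ⟨τ, hτI, hτa⟩ := exists_mem_inertia_modNCyclotomicCharacter_eq (m := p) (p := p) (k := 0)
    (d := 1) (by rw [zero_add, pow_one, mul_one]) hp'.not_dvd_one hvgen h𝔓
    (a := ZMod.unitOfCoprime 2 hcop) (Subsingleton.elim _ _)
  have hval : ((((modPCyclotomicCharacterZMod ℚ p τ : (ZMod p)ˣ) : ZMod p).val : ℤ)) = 2 := by
    rw [modPCyclotomicCharacterZMod_eq_modNCyclotomicCharacter, hτa, ZMod.coe_unitOfCoprime,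
      ZMod.val_natCast, Nat.mod_eq_of_lt (by omega)]
    norm_num
  exact ⟨v, 𝔓, τ, hv, h𝔓, Ideal.inertia_le_decompositionSubgroup (absoluteGaloisGroup ℚ) 𝔓 hτI, hval,
    smul_geomSqrt_eq_of_mem_inertia (not_dvd_four_mul hp2 hpd) hv h𝔓 hτI⟩

variable {V : WeierstrassCurve ℚ} [V.IsElliptic]

/-- **One of the two non-split members is good.** Let `E/ℚ` be elliptic, `p` odd, `Φ ≤ E[p]` a
rational `p`-line and `d ∈ ℤ` with `p ∤ d`. There are a globally minimal `W`, a `ℚ`-isogeny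
`g : E → W` of degree `p^k`, and a rational `p`-line `L ≤ W[p]` which is the ONLY rational `p`-line of
`W` and is (i) not pointwise fixed by `Γ_ℚ`, (ii) not acted on by `Γ_ℚ` through the sign character
`σ ↦ σ√d/√d`, (iii) not pointwise fixed by the decomposition groups above `p`
(`¬ LineDecompositionTrivialAt`). Proof: `E₁ = E/C_max` has the unique line `L₁` (file 1); if
`(E₁, L₁)` fails (i), (ii) or (iii) then an inertia element `τ` above `p` with `χ̄_p(τ) = 2`, which
fixes `√d`, fixes `L₁`, so acts on the unique line `L₂ ≅ E₁[p]/L₁` of `E₂ = E₁/C₁,max` by `2`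
(Mazur (5.4), file 1 §3), and `(E₂, L₂)` satisfies (i)–(iii).
[cite: KellerYin2024PotOrd, §3.1 (lattice normalisation φ|G_p ≠ 1 and E(K)[p] = 0)]
[cite: Mazur1977, Ch. III §5, (5.4), p. 157] [cite: SilvermanAEC2009, Prop. III.4.12, Cor. IX.6.2] -/
theorem exists_member_uniqueLine (hp2 : p ≠ 2) {Φ : AddSubgroup (geomTorsion V (p : ℤ))}
    (hΦ : IsRationalLine V p Φ) {d : ℤ} (hpd : ¬ (p : ℤ) ∣ d) :
    ∃ (W : WeierstrassCurve ℚ) (_ : W.IsElliptic) (_ : W.IsGloballyMinimal) (g : Isogeny V W) (k : ℕ)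
      (L : AddSubgroup (geomTorsion W (p : ℤ))),
      g.degree = p ^ k ∧ IsRationalLine W p L ∧
      (∀ Ψ : AddSubgroup (geomTorsion W (p : ℤ)), IsRationalLine W p Ψ → Ψ = L) ∧
      ¬ (∀ (σ : absoluteGaloisGroup ℚ) (P : geomTorsion W (p : ℤ)), P ∈ L → σ • P = P) ∧
      ¬ (∀ (σ : absoluteGaloisGroup ℚ) (P : geomTorsion W (p : ℤ)), P ∈ L →
          σ • P = if σ • geomSqrt ((d : ℤ) : ℚ) = geomSqrt ((d : ℤ) : ℚ) then P else -P) ∧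
      ¬ LineDecompositionTrivialAt W p L := by
  have hp' : p.Prime := hp.out
  -- step 1: the non-split member through `Φ`
  obtain ⟨W₁, hW₁, hW₁min, g₁, g₁', k₁, hdeg₁, -, -, hg₁', hker₁, hL₁, huniq₁⟩ :=
    exists_maximalCyclicQuotient hΦ
  haveI := hW₁
  by_cases hgood :
      (¬ (∀ (σ : absoluteGaloisGroup ℚ) (P : geomTorsion W₁ (p : ℤ)), P ∈ g₁'.range → σ • P = P) ∧
      ¬ (∀ (σ : absoluteGaloisGroup ℚ) (P : geomTorsion W₁ (p : ℤ)), P ∈ g₁'.range →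
          σ • P = if σ • geomSqrt ((d : ℤ) : ℚ) = geomSqrt ((d : ℤ) : ℚ) then P else -P) ∧
      ¬ LineDecompositionTrivialAt W₁ p g₁'.range)
  · exact ⟨W₁, hW₁, hW₁min, g₁, k₁, g₁'.range, hdeg₁, hL₁, huniq₁, hgood.1, hgood.2.1, hgood.2.2⟩
  -- step 2: the non-split member of `W₁` through its unique line `L₁ = g₁'(E[p])`
  obtain ⟨W₂, hW₂, hW₂min, g₂, g₂', k₂, hdeg₂, -, -, hg₂', hker₂, hL₂, huniq₂⟩ :=
    exists_maximalCyclicQuotient hL₁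
  haveI := hW₂
  -- an inertia element `τ` above `p` with `χ̄_p(τ) = 2` fixing `√d`
  obtain ⟨v, 𝔓, τ, hv, h𝔓, hτD, hτ2, hτs⟩ :=
    exists_decomposition_cyclotomic_two_smul_geomSqrt (p := p) hp2 hpd
  -- `τ` fixes `L₁` pointwise (since `W₁` is bad)
  have hfix : ∀ Q ∈ g₁'.range, τ • Q = Q := by
    by_contra hne
    push Not at hne
    obtain ⟨Q, hQ, hτQ⟩ := hne
    apply hgood
    refine ⟨fun h ↦ hτQ (h τ Q hQ), fun h ↦ hτQ ?_, fun h ↦ hτQ (h v hv 𝔓 h𝔓 τ hτD Q hQ)⟩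
    rw [h τ Q hQ, if_pos hτs]
  -- hence `τ` acts on `L₂ = g₂'(E₁[p]) ≅ E₁[p]/L₁` by `χ̄_p(τ) = 2`
  obtain ⟨Q₀, hQ₀L, hQ₀0, -, -⟩ := exists_generator_of_prime_card (p := p) g₁'.range hL₁.1
  have hQ₀ker : g₂' Q₀ = 0 := by rw [← AddMonoidHom.mem_ker, hker₂]; exact hQ₀L
  have htwo : ∀ T : geomTorsion W₁ (p : ℤ), τ • g₂' T = (2 : ℤ) • g₂' T := by
    intro T
    have h := smul_smul_map_eq_cyclotomic_smul (p := p) g₂' hg₂' hQ₀0 hQ₀ker τ (a := 1)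
      (by rw [one_smul]; exact hfix Q₀ hQ₀L) T
    rwa [one_smul, hτ2] at h
  -- so the only point of `L₂` fixed by `τ` is `O`
  have hzero : ∀ R ∈ g₂'.range, τ • R = R → R = 0 := by
    intro R hR hτR
    obtain ⟨T, rfl⟩ := AddMonoidHom.mem_range.mp hR
    have h := htwo T
    rw [hτR] at h
    calc g₂' T = (2 : ℤ) • g₂' T - g₂' T := by rw [two_zsmul, add_sub_cancel_right]
      _ = 0 := by rw [← h, sub_self]
  obtain ⟨R₀, hR₀L, hR₀0, -, -⟩ := exists_generator_of_prime_card (p := p) g₂'.range hL₂.1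
  -- the composite `E → W₂` has degree `p^{k₁+k₂}`
  have hdeg : (g₂.comp g₁).degree = p ^ (k₁ + k₂) := by
    have h1 : Nat.card (g₂.comp g₁).toAddMonoidHom.ker = Nat.card g₂.toAddMonoidHom.ker * g₁.degree :=
      AddMonoidHom.natCard_ker_comp_of_surjective g₂.toAddMonoidHom g₁.toAddMonoidHom g₁.surjective
    unfold Isogeny.degree at h1 hdeg₁ hdeg₂ ⊢
    rw [h1, hdeg₂, hdeg₁, pow_add, mul_comm]
  refine ⟨W₂, hW₂, hW₂min, g₂.comp g₁, k₁ + k₂, g₂'.range, hdeg, hL₂, huniq₂, ?_, ?_, ?_⟩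
  · exact fun h ↦ hR₀0 (hzero R₀ hR₀L (h τ R₀ hR₀L))
  · exact fun h ↦ hR₀0 (hzero R₀ hR₀L (by rw [h τ R₀ hR₀L, if_pos hτs]))
  · exact fun h ↦ hR₀0 (hzero R₀ hR₀L (h v hv 𝔓 h𝔓 τ hτD R₀ hR₀L))

end TwoStep

/-! ## §2 Consequences of a unique, non-degenerate rational line -/

section Consequences

variable {W : WeierstrassCurve ℚ} {L : AddSubgroup (geomTorsion W (p : ℤ))}

/-- **`E[p]^{Γ_ℚ} = 0`** when `E[p]` has a unique rational line which is not pointwise fixed: a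
non-zero fixed point would span a (pointwise fixed) rational line. [folklore] -/
theorem eq_zero_of_forall_smul_eq
    (huniq : ∀ Ψ : AddSubgroup (geomTorsion W (p : ℤ)), IsRationalLine W p Ψ → Ψ = L)
    (hnot : ¬ ∀ (σ : absoluteGaloisGroup ℚ) (P : geomTorsion W (p : ℤ)), P ∈ L → σ • P = P)
    {P : geomTorsion W (p : ℤ)} (hfix : ∀ σ : absoluteGaloisGroup ℚ, σ • P = P) : P = 0 := by
  haveI : NeZero (p : ℚ) := ⟨Nat.cast_ne_zero.mpr hp.out.ne_zero⟩
  by_contra hP0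
  apply hnot
  have hord : addOrderOf P = p := addOrderOf_eq_of_ne_zero W p hP0
  have hline : IsRationalLine W p (AddSubgroup.zmultiples P) := by
    refine ⟨by rw [Nat.card_zmultiples, hord], fun σ Q hQ ↦ ?_⟩
    obtain ⟨m, rfl⟩ := AddSubgroup.mem_zmultiples_iff.mp hQ
    rw [smul_comm σ m P, hfix σ]
    exact AddSubgroup.zsmul_mem _ (AddSubgroup.mem_zmultiples P) m
  intro σ Q hQ
  rw [← huniq _ hline] at hQ
  obtain ⟨m, rfl⟩ := AddSubgroup.mem_zmultiples_iff.mp hQ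
  rw [smul_comm σ m P, hfix σ]

/-- **No rational point of order `p`** on such a `W` (its geometric image would be a non-zero
`Γ_ℚ`-fixed point of `E[p]`, tree `exists_geomTorsion_of_addOrderOf_eq`). [cite: Mazur1977, Ch. III §5, p. 157] -/
theorem addOrderOf_ne
    (huniq : ∀ Ψ : AddSubgroup (geomTorsion W (p : ℤ)), IsRationalLine W p Ψ → Ψ = L)
    (hnot : ¬ ∀ (σ : absoluteGaloisGroup ℚ) (P : geomTorsion W (p : ℤ)), P ∈ L → σ • P = P)
    (R : W.toAffine.Point) : addOrderOf R ≠ p := by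
  intro hR
  obtain ⟨P₁, -, hP₁0, hP₁fix⟩ := exists_geomTorsion_of_addOrderOf_eq W hR
  exact hP₁0 (eq_zero_of_forall_smul_eq huniq hnot hP₁fix)

/-- **No rational point of order `p` on the twist `W^{(d)}`** when the unique line is not acted on
through the sign character of `√d`: along the sign-equivariant `W^{(d)}[p] ≃ W[p]` (Silverman *AEC*
X.5.4, tree `exists_signEquiv_of_twist`) a fixed point of `W^{(d)}[p]` becomes a point `Q₁` with
`σQ₁ = ±Q₁` (sign of `σ` on `√d`), spanning a rational line `= L`.
[cite: SilvermanAEC2009, X.5 Cor. 5.4] -/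
theorem addOrderOf_ne_twist
    (huniq : ∀ Ψ : AddSubgroup (geomTorsion W (p : ℤ)), IsRationalLine W p Ψ → Ψ = L)
    {d : ℤ} (hd0 : d ≠ 0)
    (hnot : ¬ ∀ (σ : absoluteGaloisGroup ℚ) (P : geomTorsion W (p : ℤ)), P ∈ L →
      σ • P = if σ • geomSqrt ((d : ℤ) : ℚ) = geomSqrt ((d : ℤ) : ℚ) then P else -P)
    (R : (W.quadraticTwist ((d : ℤ) : ℚ)).toAffine.Point) : addOrderOf R ≠ p := by
  haveI : NeZero (p : ℚ) := ⟨Nat.cast_ne_zero.mpr hp.out.ne_zero⟩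
  intro hR
  obtain ⟨P₁, -, hP₁0, hP₁fix⟩ := exists_geomTorsion_of_addOrderOf_eq (W.quadraticTwist ((d : ℤ) : ℚ)) hR
  have hd0' : ((d : ℤ) : ℚ) ≠ 0 := by exact_mod_cast hd0
  obtain ⟨e, hepos, heneg⟩ := exists_signEquiv_of_twist (W := W) (Wd := W.quadraticTwist ((d : ℤ) : ℚ))
    (p := p) hd0' 1 (one_smul _ _)
  set Q₁ : geomTorsion W (p : ℤ) := e P₁ with hQ₁
  have hQ₁0 : Q₁ ≠ 0 := fun h ↦ hP₁0 (e.injective (by rw [← hQ₁, h, map_zero]))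
  have hsign : ∀ σ : absoluteGaloisGroup ℚ,
      σ • Q₁ = if σ • geomSqrt ((d : ℤ) : ℚ) = geomSqrt ((d : ℤ) : ℚ) then Q₁ else -Q₁ := by
    intro σ
    by_cases hs : σ • geomSqrt ((d : ℤ) : ℚ) = geomSqrt ((d : ℤ) : ℚ)
    · rw [if_pos hs, hQ₁, ← hepos σ hs P₁, hP₁fix]
    · rw [if_neg hs, hQ₁]
      have h := heneg σ hs P₁
      rw [hP₁fix] at h
      have h' := congrArg Neg.neg h
      rw [neg_neg] at h'
      exact h'.symm
  apply hnot
  have hord : addOrderOf Q₁ = p := addOrderOf_eq_of_ne_zero W p hQ₁0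
  have hline : IsRationalLine W p (AddSubgroup.zmultiples Q₁) := by
    refine ⟨by rw [Nat.card_zmultiples, hord], fun σ Q hQ ↦ ?_⟩
    obtain ⟨m, rfl⟩ := AddSubgroup.mem_zmultiples_iff.mp hQ
    rw [smul_comm σ m Q₁, hsign σ]
    split_ifs
    · exact AddSubgroup.zsmul_mem _ (AddSubgroup.mem_zmultiples Q₁) m
    · rw [smul_neg]
      exact AddSubgroup.neg_mem _ (AddSubgroup.zsmul_mem _ (AddSubgroup.mem_zmultiples Q₁) m)
  intro σ Q hQ
  rw [← huniq _ hline] at hQ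
  obtain ⟨m, rfl⟩ := AddSubgroup.mem_zmultiples_iff.mp hQ
  rw [smul_comm σ m Q₁, hsign σ]
  split_ifs
  · rfl
  · rw [smul_neg]

/-- The `p`-primary component of an abelian group without elements of order `p` is trivial (an
element of order `p^j`, `j ≥ 1`, has a multiple of order `p`). [folklore] -/
theorem primaryComponent_eq_bot_of_forall_addOrderOf_ne {A : Type*} [AddCommGroup A]
    (h : ∀ x : A, addOrderOf x ≠ p) : AddCommGroup.primaryComponent A p = ⊥ := by
  have hp' : p.Prime := hp.out
  rw [eq_bot_iff]
  intro x hx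
  obtain ⟨n, hn⟩ := (AddCommGroup.mem_primaryComponent).mp hx
  rw [AddSubgroup.mem_bot]
  have hdvd : addOrderOf x ∣ p ^ n := addOrderOf_dvd_of_nsmul_eq_zero hn
  obtain ⟨j, -, hord⟩ := (Nat.dvd_prime_pow hp').mp hdvd
  rcases Nat.eq_zero_or_pos j with rfl | hjpos
  · rw [pow_zero] at hord
    exact AddMonoid.addOrderOf_eq_one_iff.mp hord
  · exfalso
    apply h ((p ^ (j - 1)) • x)
    apply addOrderOf_eq_prime
    · rw [smul_smul, ← pow_succ', Nat.sub_add_cancel hjpos, ← hord]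
      exact addOrderOf_nsmul_eq_zero x
    · intro h0
      have hdvd' : addOrderOf x ∣ p ^ (j - 1) := addOrderOf_dvd_of_nsmul_eq_zero h0
      rw [hord] at hdvd'
      have hle := Nat.le_of_dvd (pow_pos hp'.pos _) hdvd'
      have hlt : p ^ (j - 1) < p ^ j := Nat.pow_lt_pow_right hp'.one_lt (by omega)
      omega

/-- **`W(K)[p] = 0`** for a quadratic field `K` with `p ∤ d_K` (`p` odd), when the unique rational
line of `W` is neither pointwise fixed nor sign-isotypic for `√d_K`: the odd-part quadratic descent
`#W(K)[p^∞] = #W(ℚ)[p^∞] · #W^{(d_K)}(ℚ)[p^∞]` (Silverman *AEC* Ex. 10.16; tree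
`card_primaryComponent_point_baseChange_quadratic_of_odd'`, with `K = ℚ(θ)`, `θ² = d_K` from
`Quadratic.exists_sq_eq_algebraMap` and `NumberField.exists_discr_eq_mul_sq`) and §2's two
no-`p`-torsion statements. [cite: SilvermanAEC2009, X.5 Cor. 5.4 and Exercise 10.16]
[cite: KellerYin2024PotOrd, §3.1 (hypothesis E(K)[p] = 0)] -/
theorem forall_baseChange_nsmul_eq_zero [W.IsElliptic] (hp2 : p ≠ 2)
    (huniq : ∀ Ψ : AddSubgroup (geomTorsion W (p : ℤ)), IsRationalLine W p Ψ → Ψ = L)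
    (hnot : ¬ ∀ (σ : absoluteGaloisGroup ℚ) (P : geomTorsion W (p : ℤ)), P ∈ L → σ • P = P)
    {K : Type} [Field K] [NumberField K] (h2K : Module.finrank ℚ K = 2)
    (hpd : ¬ (p : ℤ) ∣ NumberField.discr K)
    (hnot' : ¬ ∀ (σ : absoluteGaloisGroup ℚ) (P : geomTorsion W (p : ℤ)), P ∈ L →
      σ • P = if σ • geomSqrt ((NumberField.discr K : ℤ) : ℚ) = geomSqrt ((NumberField.discr K : ℤ) : ℚ)
        then P else -P)
    (Q : (W.baseChange K).toAffine.Point) (hQ : p • Q = 0) : Q = 0 := by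
  -- `K = ℚ(θ')`, `θ'² = d_K`
  obtain ⟨θ, c, hθ, hc⟩ := Quadratic.exists_sq_eq_algebraMap (F := ℚ) (K := K) h2K
  obtain ⟨q, hq, hd⟩ := NumberField.exists_discr_eq_mul_sq h2K hθ hc
  have hθ' : algebraMap ℚ K q * θ ∉ Set.range (algebraMap ℚ K) := by
    rintro ⟨r, hr⟩
    apply hθ
    refine ⟨r / q, ?_⟩
    rw [map_div₀, hr, mul_div_cancel_left₀ _ ((map_ne_zero (algebraMap ℚ K)).mpr hq)]
  have hc' : (algebraMap ℚ K q * θ) ^ 2 = algebraMap ℚ K (NumberField.discr K : ℚ) := by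
    rw [mul_pow, hc, ← map_pow, ← map_mul, hd, mul_comm]
  have hd0 : NumberField.discr K ≠ 0 := fun h ↦ hpd (by rw [h]; exact dvd_zero _)
  -- the odd-part quadratic descent, with the trivial models
  have hcard := card_primaryComponent_point_baseChange_quadratic_of_odd' W h2K hθ' hc'
    (Wd := W.quadraticTwist (NumberField.discr K : ℚ)) ⟨1, one_smul _ _⟩
    (W' := W.baseChange K) ⟨1, one_smul _ _⟩ p hp2
  have h1 : Nat.card (AddCommGroup.primaryComponent W.toAffine.Point p) = 1 := by
    rw [primaryComponent_eq_bot_of_forall_addOrderOf_ne (addOrderOf_ne huniq hnot), AddSubgroup.card_bot]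
  have h2 : Nat.card
      (AddCommGroup.primaryComponent (W.quadraticTwist (NumberField.discr K : ℚ)).toAffine.Point p) = 1 := by
    rw [primaryComponent_eq_bot_of_forall_addOrderOf_ne (addOrderOf_ne_twist huniq hd0 hnot'),
      AddSubgroup.card_bot]
  -- the descent theorem carries the classical `DecidableEq ℚ` instance in the group laws of `W(ℚ)`,
  -- `W^{(d)}(ℚ)`; transport `h1`, `h2` along `Subsingleton (DecidableEq ℚ)`
  have key1 : ∀ inst : DecidableEq ℚ, Nat.card (@AddCommGroup.primaryComponent W.toAffine.Point
      (@Affine.Point.instAddCommGroup ℚ _ W.toAffine inst) p) = 1 := by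
    intro inst
    obtain rfl : inst = instDecidableEqRat := Subsingleton.elim _ _
    exact h1
  have key2 : ∀ inst : DecidableEq ℚ, Nat.card (@AddCommGroup.primaryComponent
      (W.quadraticTwist (NumberField.discr K : ℚ)).toAffine.Point
      (@Affine.Point.instAddCommGroup ℚ _ (W.quadraticTwist (NumberField.discr K : ℚ)).toAffine inst) p) = 1 := by
    intro inst
    obtain rfl : inst = instDecidableEqRat := Subsingleton.elim _ _
    exact h2
  have hone : Nat.card (AddCommGroup.primaryComponent (W.baseChange K).toAffine.Point p) = 1 := by
    rw [hcard, key1, key2]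
  have hbot : AddCommGroup.primaryComponent (W.baseChange K).toAffine.Point p = ⊥ :=
    AddSubgroup.card_eq_one.mp hone
  have hQmem : Q ∈ AddCommGroup.primaryComponent (W.baseChange K).toAffine.Point p :=
    (AddCommGroup.mem_primaryComponent).mpr ⟨1, by rw [pow_one]; exact hQ⟩
  rw [hbot, AddSubgroup.mem_bot] at hQmem
  exact hQmem

end Consequences

end Summit.BirchSwinnertonDyer.BirchSwinnertonDyer.Theorems.SchneiderFree.GoodMember

end
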